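import Summits.AnomalousDissipation.AnomalousDissipation.Theorems.MirrorVarietyTaylorGreenLoudGalerkinStatesLine
import Summits.AnomalousDissipation.AnomalousDissipation.Theorems.MirrorVarietyTaylorGreenLoudGalerkinStatesStubCriticality
import Literature.Analysis.FunctionSpaces.TorusTruncationH1
import Literature.Analysis.FunctionSpaces.TorusTrilinearH1

/-!
# Stub `stub_truncation` of the line `stagnation-plug-froth`
# (crux stmt-AnomalousDissipation-2987, `MirrorVariety.TaylorGreenLoudGalerkinStates`)

**Fourier truncation of the Newton datum** — the first third of the Brezzi–Rappaz–Raviart transfer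
(Numer. Math. 36 (1980), Part I) of a nonsingular steady state to the Galerkin spaces.  For a smooth force
`f`, a `K`-field `v` (smooth, divergence-free, mean-zero, equivariant under the three coordinate
reflections of `T³`) with energy `∫‖v‖² ≤ E₁`, loudness `ε₁ ≤ ν‖∇v‖²` and `K`-residual
`|testedForm ν f v a| ≤ η‖∇a‖` on `K`-fields `a`, and any slack `δ > 0`, the truncations
`P_N v = Torus.fourierTruncate N v` satisfy, for ALL LARGE `N` (one threshold for all tests `a`):

* (a) `P_N v` is a `K`-field (`isKField_fourierTruncate`): a trigonometric polynomial, divergence free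
  (transversal coefficients), mean-zero (`v̂(0) = 0`), and `K`-symmetric because truncation commutes with
  the conjugations `ρ_i u = R_i ∘ u ∘ R_i` (`Torus.fourierTruncate_conj_mulVecT`: `R_i² = 1` and `k ↦ k R_i`
  preserves the ball `|k|² ≤ N²`);
* (b) `P_N v` is band-limited to the punctured ball `0 < |k|² ≤ N²` (`isBandLimited_fourierTruncate`);
* (c) `∫‖P_N v‖² ≤ E₁` (Bessel);
* (d) `ε₁/2 ≤ ν‖∇P_N v‖²` eventually (`eventually_loud_fourierTruncate`: spectral Pythagoras
  `‖∇v‖² = ‖∇P_N v‖² + ‖∇(P_N v - v)‖²` and `‖∇(P_N v - v)‖ → 0`);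
* (e) `|testedForm ν f (P_N v) a| ≤ (η + δE₁)‖∇a‖` for band-limited `K`-fields `a`, eventually: against a
  band-limited test the force terms and the `ν`-terms of `testedForm ν f (P_N v) a` and `testedForm ν f v a`
  coincide (`Δa` is band-limited, `⟪P_N v, Δa⟫ = ⟪v, Δa⟫`), and the convective difference
  `∫⟪P_N v - v, ((P_N v)·∇)a⟫ + ∫⟪v, ((P_N v - v)·∇)a⟫` is at most `2C‖∇v‖‖∇(P_N v - v)‖‖∇a‖` by the
  trilinear `H¹` bound on `T³` (`Torus.abs_integral_inner_convect_le_of_hasZeroMean`: Hölder `L⁴·L⁴·L²`,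
  Ladyzhenskaya, Poincaré) and `‖∇P_N v‖ ≤ ‖∇v‖`; finally `2C‖∇v‖‖∇(P_N v - v)‖ ≤ δE₁` eventually
  (`eventually_truncationError_le`; when `∫‖v‖² = 0`, `v = 0` and the error vanishes).

Sources: F. Brezzi, J. Rappaz, P.-A. Raviart, Numer. Math. 36 (1980) 1–25, Part I (approximation of branches
of nonsingular solutions; here only the consistency part `P_N v → v` in `H¹` with the quadratic residual);
R. Temam, *Navier–Stokes Equations* (1979), Ch. II §1 (tested steady form, trilinear estimate (1.13));
J. C. Robinson, J. L. Rodrigo, W. Sadowski (2016), §4.1, Lemma 4.1 (truncations).  The general torus lemmas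
are in `Literature/Analysis/FunctionSpaces/TorusTruncationH1.lean` (truncation in `H¹`, lattice symmetries)
and `…/TorusTrilinearH1.lean` (the trilinear bound); the reflection algebra (`reflMat_mul_self`,
`vecMul_reflMat_apply`, `isKSymm_iff_refl_eq`) is reused from the landed stub file `…StubCriticality.lean`.
-/

-- `Summit.<Summit>.<Problem>` is the tree's mandated summit-side namespace (CONVENTIONS §2); for this
-- single-conjunct summit the two coincide, so the duplicate is deliberate.
set_option linter.dupNamespace false

noncomputable section

open scoped BigOperators Topology InnerProductSpace
open Filter MeasureTheory
open Literature.Analysis.FunctionSpaces Literature.Analysis.FunctionSpaces.Torus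

namespace Summit.AnomalousDissipation.AnomalousDissipation.Theorems.TaylorGreenLoudGalerkinStates.Truncation

open Summit.AnomalousDissipation.AnomalousDissipation.Theorems.TaylorGreenLoudGalerkinStates
open Summit.AnomalousDissipation.AnomalousDissipation.Theorems.TaylorGreenLoudGalerkinStates.Negative
open Summit.AnomalousDissipation.AnomalousDissipation.Theorems.TaylorGreenLoudGalerkinStates.Criticality

/-! ## `K`-fields stay `K`-fields under truncation -/

/-- The dual action `k ↦ k R_i` of a coordinate reflection preserves the frequency ball `|k|² ≤ N²`
(it preserves `|k|²`). [folklore] -/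
theorem vecMul_reflMat_mem_freqBall_iff (i : Fin 3) (N : ℕ) (k : Fin 3 → ℤ) :
    Matrix.vecMul k (reflMat i) ∈ freqBall N ↔ k ∈ freqBall N := by
  have hn : freqNormSq (Matrix.vecMul k (reflMat i)) = freqNormSq k := by
    simp only [freqNormSq, vecMul_reflMat_apply]
    refine Finset.sum_congr rfl fun j _ => ?_
    split_ifs <;> push_cast <;> ring
  rw [mem_freqBall, mem_freqBall, hn]

/-- **Truncations of `K`-symmetric fields are `K`-symmetric**: `P_N` commutes with each conjugation
`ρ_i u = R_i ∘ u ∘ R_i` (`Torus.fourierTruncate_conj_mulVecT`: `R_i² = 1` and `k ↦ k R_i` preserves the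
ball), so `ρ_i (P_N v) = P_N (ρ_i v) = P_N v`. [folklore] -/
theorem isKSymm_fourierTruncate {v : UnitAddTorus (Fin 3) → EuclideanSpace ℝ (Fin 3)} (hv : Continuous v)
    (hk : IsKSymm v) (N : ℕ) : IsKSymm (fourierTruncate N v) := by
  rw [isKSymm_iff_refl_eq] at hk ⊢
  intro i
  have h : fourierTruncate N (fun x => actVec (reflMat i) (v (Torus.mulVecT (reflMat i) x))) =
      fun x => actVec (reflMat i) (fourierTruncate N v (Torus.mulVecT (reflMat i) x)) :=
    fourierTruncate_conj_mulVecT hv (reflMat_mul_self i) (reflMat i) (vecMul_reflMat_mem_freqBall_iff i N)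
  rw [hk i] at h
  exact h.symm

/-- **Truncations of `K`-fields are `K`-fields**: smooth (a trigonometric polynomial), divergence
free (the coefficients of a smooth divergence-free field are transversal, `k · v̂(k) = 0`), mean-zero
(`v̂(0) = 0`) and `K`-symmetric (`isKSymm_fourierTruncate`). [folklore] -/
theorem isKField_fourierTruncate {v : UnitAddTorus (Fin 3) → EuclideanSpace ℝ (Fin 3)} (hv : IsKField v)
    (N : ℕ) : IsKField (fourierTruncate N v) := by
  obtain ⟨hs, hd, h0, hk⟩ := hv
  exact ⟨isSmooth_fourierTruncate N v, isDivFree_realTrigPoly (hd.isTransversal_mFourierCoeff hs (freqBall N)),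
    hasZeroMean_fourierTruncate hs.integrable h0 N, isKSymm_fourierTruncate hs.continuous hk N⟩

/-- **Truncations of `K`-fields are band-limited to the punctured ball** `0 < |k|² ≤ N²`
(`𝓕(P_N v)` vanishes off the ball, and at `k = 0` it is `v̂(0) = complexify (∫ v) = 0`). [folklore] -/
theorem isBandLimited_fourierTruncate {v : UnitAddTorus (Fin 3) → EuclideanSpace ℝ (Fin 3)}
    (hv : IsKField v) (N : ℕ) : IsBandLimited N (fourierTruncate N v) :=
  fun _k hk => mFourierCoeff_fourierTruncate_eq_zero_of_not_mem_erase hv.1.integrable hv.2.2.1 N hk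

/-- A field band-limited to the punctured ball is band-limited to the ball. [folklore] -/
theorem IsBandLimited.eq_zero_of_not_mem {N : ℕ} {a : UnitAddTorus (Fin 3) → EuclideanSpace ℝ (Fin 3)}
    (ha : IsBandLimited N a) : ∀ k ∉ freqBall N, UnitAddTorus.mFourierCoeff (EuclideanSpace.complexify ∘ a) k = 0 :=
  fun k hk => ha k fun h => hk (Finset.mem_of_mem_erase h)

/-! ## Loudness survives truncation, eventually -/

/-- **Loudness**: if `ε₁ ≤ ν‖∇v‖²` (`ν > 0`, `v` smooth) then `ε₁/2 ≤ ν‖∇P_N v‖²` for all large `N`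
(trivial when `ε₁ ≤ 0`; otherwise `‖∇v‖² = ‖∇P_N v‖² + ‖∇(P_N v - v)‖²` and the last term tends to `0`).
[folklore] -/
theorem eventually_loud_fourierTruncate {ν ε₁ : ℝ} {v : UnitAddTorus (Fin 3) → EuclideanSpace ℝ (Fin 3)}
    (hν : 0 < ν) (hv : IsSmooth v) (hloud : ε₁ ≤ ν * gradNormSq v) :
    ∀ᶠ N in atTop, ε₁ / 2 ≤ ν * gradNormSq (fourierTruncate N v) := by
  rcases le_or_gt ε₁ 0 with hε | hε
  · exact Eventually.of_forall fun N => by nlinarith [gradNormSq_nonneg (fourierTruncate N v)]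
  · have hT := (tendsto_gradNormSq_fourierTruncate_sub hv).const_mul ν
    rw [mul_zero] at hT
    have hev : ∀ᶠ N in atTop, ν * gradNormSq (fourierTruncate N v - v) < ε₁ / 2 :=
      (tendsto_order.1 hT).2 _ (by linarith)
    refine hev.mono fun N hN => ?_
    have hP : ν * gradNormSq v = ν * gradNormSq (fourierTruncate N v) + ν * gradNormSq (fourierTruncate N v - v) := by
      rw [gradNormSq_eq_add_fourierTruncate hv N, mul_add]
    linarith

/-! ## The tested form of a truncation against band-limited tests -/

section Tested

variable {ν : ℝ} {f v a : UnitAddTorus (Fin 3) → EuclideanSpace ℝ (Fin 3)}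

/-- On smooth data the tested form splits into its three integrals. [folklore] -/
theorem testedForm_eq_add (ν : ℝ) {f U a : UnitAddTorus (Fin 3) → EuclideanSpace ℝ (Fin 3)} (hf : IsSmooth f)
    (hU : IsSmooth U) (ha : IsSmooth a) :
    testedForm ν f U a = (∫ x, ⟪U x, convect U a x⟫_ℝ) + ν * (∫ x, ⟪U x, laplacian a x⟫_ℝ) + ∫ x, ⟪f x, a x⟫_ℝ := by
  have i1 : Integrable (fun x => ⟪U x, convect U a x⟫_ℝ) volume := (hU.inner (hU.convect ha)).integrable
  have i2 : Integrable (fun x => ν * ⟪U x, laplacian a x⟫_ℝ) volume :=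
    (hU.inner ha.laplacian).integrable.const_mul ν
  have i3 : Integrable (fun x => ⟪f x, a x⟫_ℝ) volume := (hf.inner ha).integrable
  have i12 : Integrable (fun x => ⟪U x, convect U a x⟫_ℝ + ν * ⟪U x, laplacian a x⟫_ℝ) volume := i1.add i2
  simp only [testedForm]
  rw [integral_add i12 i3, integral_add i1 i2, integral_const_mul]

/-- **The truncation error of the tested form on band-limited tests.** For smooth `f`, `v` and a
smooth test `a` with no Fourier modes off the ball `|k|² ≤ N²`,
`T(P_N v) - T(v) = ∫⟪P_N v - v, ((P_N v)·∇)a⟫ + ∫⟪v, ((P_N v - v)·∇)a⟫`, `T(U) = testedForm ν f U a`: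
the force terms coincide, the `ν`-terms coincide (`Torus.integral_inner_fourierTruncate_laplacian_eq`:
`Δa` is band-limited too), and `U ↦ ⟪U, (U·∇)a⟫` is quadratic. [folklore] -/
theorem testedForm_fourierTruncate_sub (ν : ℝ) (hf : IsSmooth f) (hv : IsSmooth v) (ha : IsSmooth a) {N : ℕ}
    (hband : ∀ k ∉ freqBall N, UnitAddTorus.mFourierCoeff (EuclideanSpace.complexify ∘ a) k = 0) :
    testedForm ν f (fourierTruncate N v) a - testedForm ν f v a =
      (∫ x, ⟪(fourierTruncate N v - v) x, convect (fourierTruncate N v) a x⟫_ℝ) +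
        ∫ x, ⟪v x, convect (fourierTruncate N v - v) a x⟫_ℝ := by
  have hP : IsSmooth (fourierTruncate N v) := isSmooth_fourierTruncate N v
  have i1 : Integrable (fun x => ⟪fourierTruncate N v x, convect (fourierTruncate N v) a x⟫_ℝ) volume :=
    (hP.inner (hP.convect ha)).integrable
  have i2 : Integrable (fun x => ⟪v x, convect v a x⟫_ℝ) volume := (hv.inner (hv.convect ha)).integrable
  have i3 : Integrable (fun x => ⟪(fourierTruncate N v - v) x, convect (fourierTruncate N v) a x⟫_ℝ) volume :=
    ((hP.sub hv).inner (hP.convect ha)).integrable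
  have i4 : Integrable (fun x => ⟪v x, convect (fourierTruncate N v - v) a x⟫_ℝ) volume :=
    (hv.inner ((hP.sub hv).convect ha)).integrable
  have hB : (∫ x, ⟪fourierTruncate N v x, convect (fourierTruncate N v) a x⟫_ℝ) - ∫ x, ⟪v x, convect v a x⟫_ℝ =
      (∫ x, ⟪(fourierTruncate N v - v) x, convect (fourierTruncate N v) a x⟫_ℝ) +
        ∫ x, ⟪v x, convect (fourierTruncate N v - v) a x⟫_ℝ := by
    rw [← integral_sub i1 i2, ← integral_add i3 i4]
    refine integral_congr_ae (ae_of_all _ fun x => ?_)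
    simp only [Torus.convect, Pi.sub_apply, map_sub, inner_sub_left, inner_sub_right]
    ring
  rw [testedForm_eq_add ν hf hP ha, testedForm_eq_add ν hf hv ha,
    integral_inner_fourierTruncate_laplacian_eq (hv.memLp 2) ha hband, ← hB]
  ring

/-- **The truncation error of the tested form, bounded on the `H¹` scale.** Given a trilinear bound
`|∫⟪u,(z·∇)a⟫| ≤ C‖∇u‖‖∇z‖‖∇a‖` on smooth zero-mean `u`, `z`, for smooth zero-mean `v`, smooth `f` and a
smooth test `a` band-limited to the ball: `|T(P_N v) - T(v)| ≤ 2C ‖∇v‖ ‖∇(P_N v - v)‖ ‖∇a‖`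
(`testedForm_fourierTruncate_sub`, the bound on each piece, and `‖∇P_N v‖ ≤ ‖∇v‖`). [folklore] -/
theorem abs_testedForm_fourierTruncate_sub_le {C : ℝ} (hC0 : 0 ≤ C)
    (hC : ∀ u z a : UnitAddTorus (Fin 3) → EuclideanSpace ℝ (Fin 3), IsSmooth u → IsSmooth z → IsSmooth a →
      HasZeroMean u → HasZeroMean z →
      |∫ x, ⟪u x, convect z a x⟫_ℝ| ≤ C * Real.sqrt (gradNormSq u) * Real.sqrt (gradNormSq z) * Real.sqrt (gradNormSq a))
    (ν : ℝ) (hf : IsSmooth f) (hv : IsSmooth v) (hv0 : HasZeroMean v) (ha : IsSmooth a) {N : ℕ}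
    (hband : ∀ k ∉ freqBall N, UnitAddTorus.mFourierCoeff (EuclideanSpace.complexify ∘ a) k = 0) :
    |testedForm ν f (fourierTruncate N v) a - testedForm ν f v a| ≤
      2 * C * Real.sqrt (gradNormSq v) * Real.sqrt (gradNormSq (fourierTruncate N v - v)) *
        Real.sqrt (gradNormSq a) := by
  have hP : IsSmooth (fourierTruncate N v) := isSmooth_fourierTruncate N v
  have hP0 : HasZeroMean (fourierTruncate N v) := hasZeroMean_fourierTruncate hv.integrable hv0 N
  have hw : IsSmooth (fourierTruncate N v - v) := hP.sub hv
  have hw0 : HasZeroMean (fourierTruncate N v - v) := by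
    show ∫ x, (fourierTruncate N v x - v x) = 0
    rw [integral_sub hP.integrable hv.integrable, show ∫ x, fourierTruncate N v x = 0 from hP0,
      show ∫ x, v x = 0 from hv0, sub_zero]
  have h1 := hC _ _ a hw hP ha hw0 hP0
  have h2 := hC v _ a hv hw ha hv0 hw0
  have hPle : Real.sqrt (gradNormSq (fourierTruncate N v)) ≤ Real.sqrt (gradNormSq v) :=
    Real.sqrt_le_sqrt (gradNormSq_fourierTruncate_le hv N)
  have hn1 : 0 ≤ C * Real.sqrt (gradNormSq (fourierTruncate N v - v)) := mul_nonneg hC0 (Real.sqrt_nonneg _)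
  have hna : 0 ≤ Real.sqrt (gradNormSq a) := Real.sqrt_nonneg _
  rw [testedForm_fourierTruncate_sub ν hf hv ha hband]
  calc |(∫ x, ⟪(fourierTruncate N v - v) x, convect (fourierTruncate N v) a x⟫_ℝ) +
          ∫ x, ⟪v x, convect (fourierTruncate N v - v) a x⟫_ℝ|
      ≤ |∫ x, ⟪(fourierTruncate N v - v) x, convect (fourierTruncate N v) a x⟫_ℝ| +
          |∫ x, ⟪v x, convect (fourierTruncate N v - v) a x⟫_ℝ| := abs_add_le _ _
    _ ≤ C * Real.sqrt (gradNormSq (fourierTruncate N v - v)) * Real.sqrt (gradNormSq (fourierTruncate N v)) *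
            Real.sqrt (gradNormSq a) +
          C * Real.sqrt (gradNormSq v) * Real.sqrt (gradNormSq (fourierTruncate N v - v)) *
            Real.sqrt (gradNormSq a) := add_le_add h1 h2
    _ ≤ C * Real.sqrt (gradNormSq (fourierTruncate N v - v)) * Real.sqrt (gradNormSq v) *
            Real.sqrt (gradNormSq a) +
          C * Real.sqrt (gradNormSq v) * Real.sqrt (gradNormSq (fourierTruncate N v - v)) *
            Real.sqrt (gradNormSq a) := by
        gcongr
    _ = 2 * C * Real.sqrt (gradNormSq v) * Real.sqrt (gradNormSq (fourierTruncate N v - v)) *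
          Real.sqrt (gradNormSq a) := by ring

end Tested

/-! ## The slack `δ E₁` absorbs the truncation error, eventually -/

/-- A continuous field with `∫ ‖v‖² = 0` vanishes identically. [folklore] -/
theorem eq_zero_of_integral_norm_sq_eq_zero {v : UnitAddTorus (Fin 3) → EuclideanSpace ℝ (Fin 3)}
    (hv : Continuous v) (h : ∫ x, ‖v x‖ ^ 2 = 0) : v = 0 := by
  have hae : (fun x => ‖v x‖ ^ 2) =ᵐ[volume] 0 :=
    (integral_eq_zero_iff_of_nonneg (fun x => sq_nonneg _) ((hv.norm.pow 2).integrable_unitAddTorus)).1 h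
  have heq : (fun x => ‖v x‖ ^ 2) = 0 := (Continuous.ae_eq_iff_eq volume (hv.norm.pow 2) continuous_zero).1 hae
  funext x
  have hx := congr_fun heq x
  simpa using hx

/-- The zero field has zero gradient norm. [folklore] -/
theorem gradNormSq_zero : gradNormSq (0 : UnitAddTorus (Fin 3) → EuclideanSpace ℝ (Fin 3)) = 0 := by
  simp [gradNormSq, partialDeriv, Torus.lineDeriv]

/-- **Eventually `2C ‖∇v‖ ‖∇(P_N v - v)‖ ≤ δ E₁`** for a smooth `v` with `∫‖v‖² ≤ E₁` and `δ > 0`: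
if `∫‖v‖² > 0` then `δE₁ > 0` and the left side tends to `0`; if `∫‖v‖² = 0` then `v = 0` and the
left side is `0 ≤ δ E₁`. The threshold depends on `v`, `C`, `δ`, `E₁` only. [folklore] -/
theorem eventually_truncationError_le {C δ E₁ : ℝ} {v : UnitAddTorus (Fin 3) → EuclideanSpace ℝ (Fin 3)}
    (hδ : 0 < δ) (hv : IsSmooth v) (hE : ∫ x, ‖v x‖ ^ 2 ≤ E₁) :
    ∀ᶠ N in atTop, 2 * C * Real.sqrt (gradNormSq v) * Real.sqrt (gradNormSq (fourierTruncate N v - v)) ≤ δ * E₁ := by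
  have hE0 : 0 ≤ ∫ x, ‖v x‖ ^ 2 := integral_nonneg fun x => sq_nonneg _
  rcases hE0.lt_or_eq with hpos | hzero
  · have hE₁ : 0 < δ * E₁ := mul_pos hδ (hpos.trans_le hE)
    have hT : Tendsto (fun N => 2 * C * Real.sqrt (gradNormSq v) * Real.sqrt (gradNormSq (fourierTruncate N v - v)))
        atTop (𝓝 (2 * C * Real.sqrt (gradNormSq v) * Real.sqrt 0)) :=
      tendsto_const_nhds.mul (tendsto_gradNormSq_fourierTruncate_sub hv).sqrt
    rw [Real.sqrt_zero, mul_zero] at hT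
    exact ((tendsto_order.1 hT).2 _ hE₁).mono fun N hN => hN.le
  · have hv0 : v = 0 := eq_zero_of_integral_norm_sq_eq_zero hv.continuous hzero.symm
    refine Eventually.of_forall fun N => ?_
    rw [hv0, gradNormSq_zero, Real.sqrt_zero, mul_zero, zero_mul]
    exact mul_nonneg hδ.le (hE0.trans hE)

/-! ## The registered stub -/

/-- **`stub_truncation`, parametrised by the trilinear constant.** The registered statement, given a bound
`|∫⟪u,(z·∇)a⟫| ≤ C‖∇u‖‖∇z‖‖∇a‖` on smooth zero-mean `u`, `z` and smooth `a` with `C ≥ 0`: combine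
`isKField_fourierTruncate`, `isBandLimited_fourierTruncate`, Bessel (`Torus.integral_norm_sq_fourierTruncate_le`),
`eventually_loud_fourierTruncate`, and — on the intersection of the two eventual ranges, whose threshold depends
on `v`, `ν`, `ε₁`, `δ`, `E₁`, `C` only — `abs_testedForm_fourierTruncate_sub_le` with
`eventually_truncationError_le`: `|T(P_N v) a| ≤ |T(v) a| + 2C‖∇v‖‖∇(P_N v - v)‖‖∇a‖ ≤ (η + δE₁)‖∇a‖`
(the consistency half of Brezzi–Rappaz–Raviart 1980, Part I, for the Fourier–Galerkin spaces). [folklore] -/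
theorem stub_truncation_of_trilinear {C : ℝ} (hC0 : 0 ≤ C)
    (hC : ∀ u z a : UnitAddTorus (Fin 3) → EuclideanSpace ℝ (Fin 3), IsSmooth u → IsSmooth z → IsSmooth a →
      HasZeroMean u → HasZeroMean z →
      |∫ x, ⟪u x, convect z a x⟫_ℝ| ≤ C * Real.sqrt (gradNormSq u) * Real.sqrt (gradNormSq z) * Real.sqrt (gradNormSq a)) :
    ∀ (ν η E₁ ε₁ δ : ℝ) (f v : UnitAddTorus (Fin 3) → EuclideanSpace ℝ (Fin 3)), 0 < ν → 0 < δ → IsSmooth f → IsKField v → ∫ x, ‖v x‖ ^ 2 ≤ E₁ → ε₁ ≤ ν * gradNormSq v → (∀ a, IsKField a → |testedForm ν f v a| ≤ η * Real.sqrt (gradNormSq a)) → ∀ᶠ N in Filter.atTop, IsKField (fourierTruncate N v) ∧ IsBandLimited N (fourierTruncate N v) ∧ ∫ x, ‖fourierTruncate N v x‖ ^ 2 ≤ E₁ ∧ ε₁ / 2 ≤ ν * gradNormSq (fourierTruncate N v) ∧ ∀ a, IsKField a → IsBandLimited N a → |testedForm ν f (fourierTruncate N v) a| ≤ (η + δ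 * E₁) * Real.sqrt (gradNormSq a) := by
  intro ν η E₁ ε₁ δ f v hν hδ hf hv hE hloud hres
  have hvs : IsSmooth v := hv.1
  have hv0 : HasZeroMean v := hv.2.2.1
  filter_upwards [eventually_loud_fourierTruncate hν hvs hloud, eventually_truncationError_le (C := C) hδ hvs hE]
    with N hloudN herrN
  refine ⟨isKField_fourierTruncate hv N, isBandLimited_fourierTruncate hv N,
    (integral_norm_sq_fourierTruncate_le (hvs.memLp 2) N).trans hE, hloudN, fun a ha hba => ?_⟩
  have has : IsSmooth a := ha.1
  have hdiff := abs_testedForm_fourierTruncate_sub_le hC0 hC ν hf hvs hv0 has (IsBandLimited.eq_zero_of_not_mem hba)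
  have hga : 0 ≤ Real.sqrt (gradNormSq a) := Real.sqrt_nonneg _
  have h1 : |testedForm ν f (fourierTruncate N v) a| ≤
      |testedForm ν f v a| + |testedForm ν f (fourierTruncate N v) a - testedForm ν f v a| := by
    have := abs_add_le (testedForm ν f v a) (testedForm ν f (fourierTruncate N v) a - testedForm ν f v a)
    rwa [add_sub_cancel] at this
  calc |testedForm ν f (fourierTruncate N v) a|
      ≤ |testedForm ν f v a| + |testedForm ν f (fourierTruncate N v) a - testedForm ν f v a| := h1
    _ ≤ η * Real.sqrt (gradNormSq a) +
          2 * C * Real.sqrt (gradNormSq v) * Real.sqrt (gradNormSq (fourierTruncate N v - v)) *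
            Real.sqrt (gradNormSq a) := add_le_add (hres a ha) hdiff
    _ ≤ η * Real.sqrt (gradNormSq a) + δ * E₁ * Real.sqrt (gradNormSq a) := by
        gcongr
    _ = (η + δ * E₁) * Real.sqrt (gradNormSq a) := by ring


/-- **Stub `stub_truncation`.** For a smooth force `f`, a `K`-field `v` with `∫‖v‖² ≤ E₁`, `ε₁ ≤ ν‖∇v‖²` and
`K`-residual `≤ η‖∇a‖`, and a slack `δ > 0`: for all large `N` the Fourier truncation `P_N v` is a band-limited
`K`-field with `∫‖P_N v‖² ≤ E₁`, `ε₁/2 ≤ ν‖∇P_N v‖²`, and `K`-residual `≤ (η + δE₁)‖∇a‖` on band-limited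
`K`-fields `a` (`stub_truncation_of_trilinear` with the constant of
`Torus.abs_integral_inner_convect_le_of_hasZeroMean` on `T³`). [folklore] -/
theorem stub_truncation : ∀ (ν η E₁ ε₁ δ : ℝ) (f v : UnitAddTorus (Fin 3) → EuclideanSpace ℝ (Fin 3)), 0 < ν → 0 < δ → IsSmooth f → IsKField v → ∫ x, ‖v x‖ ^ 2 ≤ E₁ → ε₁ ≤ ν * gradNormSq v → (∀ a, IsKField a → |testedForm ν f v a| ≤ η * Real.sqrt (gradNormSq a)) → ∀ᶠ N in Filter.atTop, IsKField (fourierTruncate N v) ∧ IsBandLimited N (fourierTruncate N v) ∧ ∫ x, ‖fourierTruncate N v x‖ ^ 2 ≤ E₁ ∧ ε₁ / 2 ≤ ν * gradNormSq (fourierTruncate N v) ∧ ∀ a, IsKField a → IsBandLimited N a → |testedForm ν f (fourierTruncate N v) a| ≤ (η + δ * E₁) * Real.sqrt (gradNormSq a) := by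
  obtain ⟨C, hC0, hC⟩ := abs_integral_inner_convect_le_of_hasZeroMean (d := Fin 3) (Fintype.card_fin 3)
  exact stub_truncation_of_trilinear hC0 hC

end Summit.AnomalousDissipation.AnomalousDissipation.Theorems.TaylorGreenLoudGalerkinStates.Truncation

end
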